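import Literature.NumberTheory.EllipticCurves.OpenImageMazurCharacterProofs
import HarnessLib

/-!
# Route `EisensteinPrimes`, crux 2 `GoodLatticeBDPValue` (stmt-BirchSwinnertonDyer-19032), line `halves`, AN-3 Stub B
# (`FullDescentAtThreeOfRed`), global input F5 (Kummer splitting lemma), MODULE-THEORETIC PRELIMINARIES: index-`3`
# subgroups of an abelian group and the values of the mod `3` cyclotomic character

Cell `bsd-eis` (home `run/shared/lean/pub/bsd-eis/`), width seat `bsd-line-x1-p1-w2` (gen 5; `--supports -19032`, closes
nothing by itself). Elementary lemmas used by the Kummer splitting lemma (sibling file `…FullDescentKummerSplitting`,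
AN-3 road memo `HOME/line-x1-p1-w3-g4/AN3-StubB-elementary-road.md` F5) in its RELATIVE formulation `L ≤ N ≤ M` (no
quotient types):

* `exists_zsmul_sub_mem_of_card` — `L ≤ N`, `#N = 3·#L ≠ 0`, `a ∈ N ∖ L` ⟹ `N = L + ℤa` (the quotient `N/L` has prime
  order `3`, Mathlib `mem_zmultiples_of_prime_card`);
* `three_dvd_of_zsmul_mem` — `3x ∈ P`, `x ∉ P`, `jx ∈ P` ⟹ `3 ∣ j` (Bezout);
* `exists_mem_not_mem_of_card` — `#N = 3·#L ≠ 0` ⟹ `N ⊄ L`;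
* `val_modNCyclotomicCharacter_three` — `χ̄₃(σ) ∈ {1, 2} ⊂ ℤ/3`.

HONEST FRAMING: helper theorems only (0 definitions, 0 named facts, 0 sorry); no summit statement, no BSD / IMC2 /
Keller–Yin theorem, no stub of the registered skeleton is proved here. [folklore]
-/

set_option autoImplicit false
-- the route's Theorems namespace repeats the summit name by design (D-0017 nested layout)
set_option linter.dupNamespace false

noncomputable section

open scoped Classical

namespace Summit.BirchSwinnertonDyer.BirchSwinnertonDyer.Theorems.FullDescentKummerModule

open Function Field Literature.NumberTheory.GaloisRepresentations

/-! ## §1. Index-`3` subgroups -/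

section Module

variable {V : Type*} [AddCommGroup V]

/-- **An index-`3` subgroup is `L + ℤa` for any `a ∈ N ∖ L`**: if `L ≤ N` with `#N = 3·#L` (finite) and `a ∈ N`, `a ∉ L`,
then every `y ∈ N` is `≡ k a (mod L)` for some `k ∈ ℤ` (the quotient `N/L` has prime order `3`, so any non-zero class
generates it, Mathlib `mem_zmultiples_of_prime_card`). [folklore] -/
theorem exists_zsmul_sub_mem_of_card {L N : AddSubgroup V} (hLN : L ≤ N) {c : ℕ} (hc : c ≠ 0)
    (hcL : Nat.card L = c) (hcN : Nat.card N = 3 * c) {a : V} (haN : a ∈ N) (haL : a ∉ L) :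
    ∀ y ∈ N, ∃ k : ℤ, y - k • a ∈ L := by
  intro y hy
  haveI : Fact (Nat.Prime 3) := ⟨Nat.prime_three⟩
  set H : AddSubgroup N := L.addSubgroupOf N with hH
  have hcardH : Nat.card H = c := by
    rw [hH, Nat.card_congr (AddSubgroup.addSubgroupOfEquivOfLe hLN).toEquiv, hcL]
  have hindex : H.index = 3 := by
    have h := H.card_mul_index
    rw [hcardH, hcN] at h
    have : c * H.index = c * 3 := by linarith
    exact Nat.eq_of_mul_eq_mul_left (Nat.pos_of_ne_zero hc) this
  have hcardQ : Nat.card (N ⧸ H) = 3 := by rw [← AddSubgroup.index_eq_card, hindex]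
  have ha0 : (QuotientAddGroup.mk (⟨a, haN⟩ : N) : N ⧸ H) ≠ 0 := by
    intro h
    rw [QuotientAddGroup.eq_zero_iff, hH, AddSubgroup.mem_addSubgroupOf] at h
    exact haL h
  have hmem := mem_zmultiples_of_prime_card hcardQ ha0 (g' := (QuotientAddGroup.mk (⟨y, hy⟩ : N) : N ⧸ H))
  rw [AddSubgroup.mem_zmultiples_iff] at hmem
  obtain ⟨k, hk⟩ := hmem
  refine ⟨k, ?_⟩
  rw [← QuotientAddGroup.mk_zsmul, QuotientAddGroup.eq, hH, AddSubgroup.mem_addSubgroupOf] at hk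
  -- `hk : ↑(-(k • ⟨a, _⟩) + ⟨y, _⟩) ∈ L`
  have : ((-(k • (⟨a, haN⟩ : N)) + ⟨y, hy⟩ : N) : V) = y - k • a := by
    simp only [AddSubgroup.coe_add, AddSubgroup.coe_neg, AddSubgroupClass.coe_zsmul]
    abel
  rw [this] at hk
  exact hk

/-- **`3 ∣ j` from `jx ∈ P`** when `3x ∈ P` but `x ∉ P` (Bezout: otherwise `gcd(3, j) = 1` and `x ∈ P`). [folklore] -/
theorem three_dvd_of_zsmul_mem {P : AddSubgroup V} {x : V} (h3 : (3 : ℤ) • x ∈ P) (hx : x ∉ P) {j : ℤ}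
    (hj : j • x ∈ P) : (3 : ℤ) ∣ j := by
  by_contra h
  have hcop : IsCoprime (3 : ℤ) j := (Int.prime_three.coprime_iff_not_dvd).mpr h
  obtain ⟨u, v, huv⟩ := hcop
  apply hx
  have : x = u • ((3 : ℤ) • x) + v • (j • x) := by
    rw [smul_smul, smul_smul, ← add_smul, huv, one_smul]
  rw [this]
  exact P.add_mem (P.zsmul_mem h3 u) (P.zsmul_mem hj v)

/-- There is an element of `N` outside `L` when `#N = 3·#L ≠ 0`. [folklore] -/
theorem exists_mem_not_mem_of_card {L N : AddSubgroup V} (hLN : L ≤ N) {c : ℕ} (hc : c ≠ 0)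
    (hcL : Nat.card L = c) (hcN : Nat.card N = 3 * c) : ∃ a ∈ N, a ∉ L := by
  by_contra h
  push Not at h
  have hNL : N = L := le_antisymm (fun x hx ↦ h x hx) hLN
  have : Nat.card N = Nat.card L := by rw [hNL]
  rw [hcL, hcN] at this
  omega

end Module

/-! ## §2. The mod `3` cyclotomic character -/


/-- The mod `3` cyclotomic character takes the values `1, 2` in `ℤ/3`. [folklore] -/
theorem val_modNCyclotomicCharacter_three (σ : absoluteGaloisGroup ℚ) :
    ((modNCyclotomicCharacter ℚ 3 σ : (ZMod 3)ˣ) : ZMod 3).val = 1 ∨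
      ((modNCyclotomicCharacter ℚ 3 σ : (ZMod 3)ˣ) : ZMod 3).val = 2 := by
  have hlt : ((modNCyclotomicCharacter ℚ 3 σ : (ZMod 3)ˣ) : ZMod 3).val < 3 := ZMod.val_lt _
  have hne : ((modNCyclotomicCharacter ℚ 3 σ : (ZMod 3)ˣ) : ZMod 3).val ≠ 0 := by
    rw [ne_eq, ZMod.val_eq_zero]
    exact (modNCyclotomicCharacter ℚ 3 σ).ne_zero
  omega

end Summit.BirchSwinnertonDyer.BirchSwinnertonDyer.Theorems.FullDescentKummerModule

end
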